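/-
Copyright (c) 2026 the pub-hodgecm-mathlib formalisation cell (harness21).  Prover seat hodgecm-mathlib-K2Liu-p08 (g2), Track B «K2-LIT»,
#184♮ = hLiu418 = `stmt-HodgeConjecture-24832`; LEAD F0P6-plan (g13) RULING «M-157i′» (2) 2026-09-04T08:56:04Z (G5-a (α)), faces «M-157b» (β0)–(β4);
census `K2/K2Liu-p08/g2/CENSUS-G5a-alpha-MiddleCellGL2.K2Liu-p08-g2.md`; LEAD «M-157k» (3) 2026-09-04T09:06:44Z «ACCEPTED AS CAPITAL».  Road Φ of socket #41, organ G5-a = Φ7-2: the GL-side junction (β0)∕(β4-iii) → ★ (γ).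
-/
import Summits.HodgeConjecture.HodgeConjecture.Theorems.K2LiuSiegelEisensteinRankZeroTermPackage   -- ★ (γ) `exists_middle_package` (+ ★ Φ7c, ★ mirabolic capital)
import Mathlib.LinearAlgebra.Dual.Lemmas
import HarnessLib

/-!
# Crux `HLiu418`, Road Φ, organ G5-a (Φ7-2) sub-organ (α), file (α-GL2): THE MIDDLE CELL OF THE CONSTANT TERM AS A FINITE SUM OF
# `GL_n(𝔸_L)` MIRABOLIC EISENSTEIN SERIES OF GODEMENT SECTIONS — the GL-side junction to ★ (γ) `exists_middle_package`

Cell `hodgecm-mathlib`, crux item hLiu418 = `stmt-HodgeConjecture-24832` (helper lane `--supports`, count-neutral).  THEOREMS ONLY (no `def`, no instance,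
no notation, no named-fact hypothesis, no `sorry`).  Generic number field `L`, generic `n`, abstract parameter space `X` (the consumer takes `X = H(𝔸)`,
`n = 2`); hypothesis-first on the GEOMETRIC UNFOLD (α-U) (the identity `MID(s)(x) = c₀ · Σ_{γ ∈ B(L)∖GL₂(L)} φ_s^x(γ · m(x))` in the ★ D9 frame — a separate
file) and on the faces (β0) (the inner section family in a FLAT `K`-finite basis, M-157b) and (β) (Godement exhaust of the flat basis, K2Liu-p14 (g0)).
* §1 (β0)'s ONE LINEAR-ALGEBRA LEMMA: in a finite-dimensional space `W` of functions `κ → ℂ` the evaluations span the dual (`span_eval_eq_top`), so every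
  coordinate functional is a FINITE combination of evaluations (`exists_finsupp_eval_eq`); hence a family `φ s ∈ span b` (`b` linearly independent) that is
  holomorphic POINTWISE (`s ↦ φ s x` for each `x`) has holomorphic coordinates, bounded where `φ` is bounded (**`exists_holomorphic_coords`**).
* §2 `eq_sum_of_eqOn_of_law` — equality of a section with a finite combination of sections on `K` + a shared multiplier law under `P` + `G = P·K` ⇒ equality on `G`.
* §3 `summable_tateVectorIntegral_of_mem_piSchwartzBruhat` (the `ℙ^{n−1}(L)`-series of Tate vector integrals of `Φ ∈ piSchwartzBruhat` is absolutely summable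
  for `re s > 1`, ★ `tsum_lintegral_enorm_smul_lt_top_of_mem_piSchwartzBruhat`); `godement_ratGL_mul`, `tateVectorIntegral_line` (rational translates:
  `|det γ̂|_𝔸 = 1` ★ `ideleNorm_det_map_eq_one`, ★ `ratVec_vecMul`, ★ `tateVectorIntegral_ratVec_smul`).
* §4 **`middle_eq_sum_mirabolicEisenstein`** — from (α-U) `MID s x = c₀ · Σ'_{p ∈ ℙ^{n−1}(L)} φ s x (γ̂_p · m x)` (representatives `γ_p ∈ GL_n(L)` with `e₀ γ_p ∈ Lˣ·p`),
  (β0) `φ s x g = Σ_i λ_i(s,x) b_i(s,g)` and (β) `b_i(s,g) = Σ_j κ_{ij}(s) |det g|^{s+½} Z(Φ_{ij}; s+½; e₀ g)`:  `MID s x = Σ_{(i,j)} (c₀ λ_i κ_{ij})(s,x) · E(m x, Φ_{ij}; s+½)`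
  on `c < re s` (`½ ≤ c`) — LITERALLY the `hMID` binder of ★ (γ), with `had_of_face`∕`hag_of_face` its `had`∕`hag` binders.
[MoeglinWaldspurger1995, II.1.7] [CogdellAnalyticTheory2004, §2.3] [JacquetShalikaAJM1981, §4] [KudlaRallis1994, §1] [Tan1999, §4].
HONEST LABEL.  Count-neutral helper; `HC_CM` is proved only modulo the 7 printed citations (2 remaining named inputs: hLiu418 = `stmt-HodgeConjecture-24832`,
h413 = `stmt-HodgeConjecture-24833`) until rung 0 closes.
-/

set_option autoImplicit false
set_option linter.dupNamespace false -- the mandated namespace repeats `HodgeConjecture.HodgeConjecture`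

noncomputable section

namespace Summit.HodgeConjecture.HodgeConjecture.Cruxes.HLiu418.K2LiuMiddleCellGodementJunction

open Set Filter Topology Metric Complex
open scoped BigOperators MatrixGroups NNReal ENNReal Matrix
open NumberField IsDedekindDomain MeasureTheory
open Literature.NumberTheory.Automorphic
open Literature.NumberTheory.GaloisRepresentations (ideleGroup)

/-! ## §1 Coordinates of a pointwise-holomorphic family in a fixed finite-dimensional space of functions -/

section Coords

variable {κ : Type*}

/-- **evaluations span the dual** of a finite-dimensional space `W` of functions `κ → ℂ` (a functional orthogonal to all evaluations would have a
non-zero vector in its coannihilator, i.e. a non-zero function vanishing everywhere). [folklore] -/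
theorem span_eval_eq_top (W : Submodule ℂ (κ → ℂ)) [FiniteDimensional ℂ W] :
    Submodule.span ℂ (Set.range fun x : κ => ((LinearMap.proj x).comp W.subtype : Module.Dual ℂ W)) = ⊤ := by
  by_contra hne
  set U : Submodule ℂ (Module.Dual ℂ W) :=
    Submodule.span ℂ (Set.range fun x : κ => ((LinearMap.proj x).comp W.subtype : Module.Dual ℂ W)) with hU
  have hlt : Module.finrank ℂ U < Module.finrank ℂ (Module.Dual ℂ W) := Submodule.finrank_lt hne
  rw [Subspace.dual_finrank_eq] at hlt
  have hsum := Subspace.finrank_add_finrank_dualCoannihilator_eq U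
  have hpos : U.dualCoannihilator ≠ ⊥ := by
    intro h
    rw [h, finrank_bot] at hsum
    omega
  obtain ⟨w, hw, hw0⟩ := (Submodule.ne_bot_iff _).1 hpos
  refine hw0 (Subtype.ext (funext fun x => ?_))
  have h := (Submodule.mem_dualCoannihilator w).1 hw ((LinearMap.proj x).comp W.subtype) (Submodule.subset_span ⟨x, rfl⟩)
  simpa using h

/-- every linear functional on `W` is a FINITE linear combination of evaluations. [folklore] -/
theorem exists_finsupp_eval_eq (W : Submodule ℂ (κ → ℂ)) [FiniteDimensional ℂ W] (ℓ : Module.Dual ℂ W) :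
    ∃ c : κ →₀ ℂ, ∀ w : W, ℓ w = c.sum fun x a => a * (w : κ → ℂ) x := by
  have h : ℓ ∈ Submodule.span ℂ (Set.range fun x : κ => ((LinearMap.proj x).comp W.subtype : Module.Dual ℂ W)) := by
    rw [span_eval_eq_top]; trivial
  obtain ⟨c, hc⟩ := Finsupp.mem_span_range_iff_exists_finsupp.1 h
  refine ⟨c, fun w => ?_⟩
  rw [← hc]
  simp only [Finsupp.sum, LinearMap.coe_sum, Finset.sum_apply, LinearMap.smul_apply, LinearMap.coe_comp, Function.comp_apply,
    Submodule.coe_subtype, LinearMap.coe_proj, Function.eval, smul_eq_mul]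

/-- **(β0) COORDINATES OF A POINTWISE-HOLOMORPHIC FAMILY ARE HOLOMORPHIC.**  Let `b : d → (κ → ℂ)` be linearly independent (`d` finite) and
`φ : ℂ → (κ → ℂ)` with `φ s ∈ span b` for `s ∈ U` and `s ↦ φ s x` holomorphic on `U` for every `x`.  Then there are `l i : ℂ → ℂ`, holomorphic on `U`,
with `φ s = Σ_i l i s • b i` on `U`, and `‖l i s‖ ≤ M · C` whenever `‖φ s x‖ ≤ C` for all `x` (one `M ≥ 0` for all `s`, `i`): each coordinate functional is a
finite combination of evaluations (`exists_finsupp_eval_eq`). [cite: MoeglinWaldspurger1995, II.1.7] -/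
theorem exists_holomorphic_coords {d : Type*} [Fintype d] {b : d → κ → ℂ} (hb : LinearIndependent ℂ b) {U : Set ℂ} {φ : ℂ → κ → ℂ}
    (hφ : ∀ s ∈ U, φ s ∈ Submodule.span ℂ (Set.range b)) (hφd : ∀ x, DifferentiableOn ℂ (fun s => φ s x) U) :
    ∃ l : d → ℂ → ℂ, (∀ i, DifferentiableOn ℂ (l i) U) ∧ (∀ s ∈ U, φ s = ∑ i, l i s • b i) ∧
      ∃ M : ℝ, 0 ≤ M ∧ ∀ (s : ℂ) (C : ℝ), (∀ x, ‖φ s x‖ ≤ C) → ∀ i, ‖l i s‖ ≤ M * C := by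
  classical
  set W : Submodule ℂ (κ → ℂ) := Submodule.span ℂ (Set.range b) with hW
  haveI : FiniteDimensional ℂ W := FiniteDimensional.span_of_finite ℂ (Set.finite_range b)
  set bW : Module.Basis d ℂ W := Module.Basis.span hb with hbW
  choose c hc using fun i => exists_finsupp_eval_eq W (bW.coord i)
  refine ⟨fun i s => (c i).sum fun x a => a * φ s x, fun i => ?_, fun s hs => ?_, ?_⟩
  · -- holomorphy: a finite sum of multiples of the pointwise-holomorphic `s ↦ φ s x`
    simp only [Finsupp.sum]
    exact DifferentiableOn.fun_sum fun x _ => (hφd x).const_mul _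
  · -- the representation on `U`
    have hrepr := bW.sum_repr ⟨φ s, hφ s hs⟩
    have hcoe := congrArg (fun w : W => (w : κ → ℂ)) hrepr
    simp only [Submodule.coe_sum, Submodule.coe_smul] at hcoe
    rw [← hcoe]
    refine Finset.sum_congr rfl fun i _ => ?_
    rw [show (bW i : κ → ℂ) = b i from Module.Basis.coe_span_apply hb i, ← Module.Basis.coord_apply, hc i]
  · -- the bound
    refine ⟨∑ i, ∑ x ∈ (c i).support, ‖c i x‖, Finset.sum_nonneg fun i _ => Finset.sum_nonneg fun x _ => norm_nonneg _, fun s C hC i => ?_⟩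
    by_cases hC0 : 0 ≤ C
    · simp only [Finsupp.sum]
      calc ‖∑ x ∈ (c i).support, c i x * φ s x‖ ≤ ∑ x ∈ (c i).support, ‖c i x‖ * C := by
            refine (norm_sum_le _ _).trans (Finset.sum_le_sum fun x _ => ?_)
            rw [norm_mul]; exact mul_le_mul_of_nonneg_left (hC x) (norm_nonneg _)
        _ = (∑ x ∈ (c i).support, ‖c i x‖) * C := (Finset.sum_mul _ _ _).symm
        _ ≤ (∑ i, ∑ x ∈ (c i).support, ‖c i x‖) * C :=
            mul_le_mul_of_nonneg_right (Finset.single_le_sum (f := fun i => ∑ x ∈ (c i).support, ‖c i x‖)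
              (fun i _ => Finset.sum_nonneg fun x _ => norm_nonneg _) (Finset.mem_univ i)) hC0
    · -- `C < 0` forces `κ` to be empty, and then everything vanishes
      haveI : IsEmpty κ := ⟨fun x => hC0 ((norm_nonneg _).trans (hC x))⟩
      have h0 : ∀ i, (c i).support = ∅ := fun i => Finset.eq_empty_of_isEmpty _
      simp [Finsupp.sum, h0]

end Coords

/-! ## §2 Extension from `K` to `G` by a shared multiplier law -/

section Law

/-- **equality on `K` + a shared multiplier law under `P` + `G = P·K` ⇒ equality on `G`** (Iwasawa-type extension of an identity between sections).
[cite: MoeglinWaldspurger1995, II.1.7] -/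
theorem eq_sum_of_eqOn_of_law {G : Type*} [Mul G] {P K : Set G} (hPK : ∀ g, ∃ p ∈ P, ∃ k ∈ K, g = p * k)
    {ι : Type*} [Fintype ι] {φ : G → ℂ} {bb : ι → G → ℂ} {χ : G → ℂ} {l : ι → ℂ}
    (hφ : ∀ p ∈ P, ∀ g, φ (p * g) = χ p * φ g) (hb : ∀ i, ∀ p ∈ P, ∀ g, bb i (p * g) = χ p * bb i g)
    (heq : ∀ k ∈ K, φ k = ∑ i, l i * bb i k) : ∀ g, φ g = ∑ i, l i * bb i g := by
  intro g
  obtain ⟨p, hp, k, hk, rfl⟩ := hPK g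
  rw [hφ p hp k, heq k hk, Finset.mul_sum]
  exact Finset.sum_congr rfl fun i _ => by rw [hb i p hp k]; ring

end Law

/-! ## §3 The `ℙ^{n−1}(L)`-series of Tate vector integrals: summability for `piSchwartzBruhat`, rational translates -/

section Series

variable {L : Type} [Field L] [NumberField L] {n : ℕ}
variable [MeasurableSpace (AdeleRing (𝓞 L) L)] [BorelSpace (AdeleRing (𝓞 L) L)]
  (ν : Measure (ideleGroup L))

/-- **absolute summability of the mirabolic series over `ℙ^{n−1}(L)`** for `Φ ∈ piSchwartzBruhat L (Fin n)` and `re s > 1` (the finite Eisenstein majorant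
★ `tsum_lintegral_enorm_smul_lt_top_of_mem_piSchwartzBruhat` dominates the norms of the Tate vector integrals).
[cite: JacquetShalikaAJM1981, §4] [cite: CogdellAnalyticTheory2004, §2.3] -/
theorem summable_tateVectorIntegral_of_mem_piSchwartzBruhat [ν.IsHaarMeasure] {Φ : (Fin n → AdeleRing (𝓞 L) L) → ℂ}
    (hΦ : Φ ∈ piSchwartzBruhat L (Fin n)) {s : ℂ} (hs : 1 < s.re) (g : GL (Fin n) (AdeleRing (𝓞 L) L)) :
    Summable fun p : Projectivization L (Fin n → L) =>
      tateVectorIntegral L ν Φ s (ratVec L p.rep ᵥ* (g : Matrix (Fin n) (Fin n) (AdeleRing (𝓞 L) L))) := by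
  haveI := borelSpace_ideleGroup L
  have htot := tsum_lintegral_enorm_smul_lt_top_of_mem_piSchwartzBruhat L ν hΦ hs g
  have hc : Continuous Φ := continuous_of_mem_piSchwartzBruhat hΦ
  set T : Projectivization L (Fin n → L) → ℝ≥0∞ := fun p =>
    ∫⁻ a, (‖Φ ((a : AdeleRing (𝓞 L) L) • (ratVec L p.rep ᵥ* (g : Matrix (Fin n) (Fin n) (AdeleRing (𝓞 L) L))))‖ₑ : ℝ≥0∞) *
      ENNReal.ofReal ((IdeleClassGroup.ideleNorm L a : ℝ) ^ ((n : ℝ) * s.re)) ∂ν with hT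
  have hTfin : ∀ p, T p ≠ ⊤ := fun p => (lt_of_le_of_lt (ENNReal.le_tsum p) htot).ne
  have hle : ∀ p : Projectivization L (Fin n → L),
      ‖tateVectorIntegral L ν Φ s (ratVec L p.rep ᵥ* (g : Matrix (Fin n) (Fin n) (AdeleRing (𝓞 L) L)))‖ ≤ (T p).toReal := by
    intro p
    refine (norm_integral_le_integral_norm _).trans (le_of_eq ?_)
    rw [integral_norm_eq_lintegral_enorm ((continuous_eisensteinKernel L hc s _).aestronglyMeasurable)]
    congr 1
    exact lintegral_congr fun a => enorm_eisensteinKernel L Φ s _ a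
  exact Summable.of_norm_bounded (ENNReal.summable_toReal htot.ne) hle

omit [BorelSpace (AdeleRing (𝓞 L) L)] in
/-- **rational translates**: `|det(γ̂ g)|^s · Z(Φ; s; ê₀ (γ̂ g)) = |det g|^s · Z(Φ; s; (e₀ γ)^ g)` for `γ ∈ GL_n(L)` (`|det γ̂|_𝔸 = 1`, ★ `ideleNorm_det_map_eq_one`;
`ê₀ γ̂ = (e₀ γ)^`, ★ `ratVec_vecMul`). [cite: CogdellAnalyticTheory2004, §2.3] -/
theorem godement_ratGL_mul (Φ : (Fin n → AdeleRing (𝓞 L) L) → ℂ) (s : ℂ) (e₀ : Fin n → L) (γ : GL (Fin n) L)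
    (g : GL (Fin n) (AdeleRing (𝓞 L) L)) :
    ((IdeleClassGroup.ideleNorm L (Matrix.GeneralLinearGroup.det
        (Matrix.GeneralLinearGroup.map (algebraMap L (AdeleRing (𝓞 L) L)) γ * g)) : ℝ) : ℂ) ^ s *
      tateVectorIntegral L ν Φ s (ratVec L e₀ ᵥ*
        ((Matrix.GeneralLinearGroup.map (algebraMap L (AdeleRing (𝓞 L) L)) γ * g : GL (Fin n) (AdeleRing (𝓞 L) L)) :
          Matrix (Fin n) (Fin n) (AdeleRing (𝓞 L) L))) =
    ((IdeleClassGroup.ideleNorm L (Matrix.GeneralLinearGroup.det g) : ℝ) : ℂ) ^ s *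
      tateVectorIntegral L ν Φ s (ratVec L (e₀ ᵥ* (γ : Matrix (Fin n) (Fin n) L)) ᵥ* (g : Matrix (Fin n) (Fin n) (AdeleRing (𝓞 L) L))) := by
  rw [map_mul, map_mul, ideleNorm_det_map_eq_one, one_mul, ratVec_vecMul, Matrix.vecMul_vecMul,
    ← Matrix.GeneralLinearGroup.coe_mul]

/-- **only the line matters**: if `e₀ γ = c • ξ_p` with `c ≠ 0` then the Tate vector integral at `(e₀ γ)^ g` is the `p`-summand of ★ `mirabolicEisenstein`
(★ `tateVectorIntegral_ratVec_smul`). [cite: CogdellAnalyticTheory2004, §2.3] -/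
theorem tateVectorIntegral_line [ν.IsMulRightInvariant] (Φ : (Fin n → AdeleRing (𝓞 L) L) → ℂ) (s : ℂ) {v : Fin n → L}
    {p : Projectivization L (Fin n → L)} {c : L} (hc : c ≠ 0) (hv : v = c • p.rep) (M : Matrix (Fin n) (Fin n) (AdeleRing (𝓞 L) L)) :
    tateVectorIntegral L ν Φ s (ratVec L v ᵥ* M) = tateVectorIntegral L ν Φ s (ratVec L p.rep ᵥ* M) := by
  rw [hv, show c • p.rep = (Units.mk0 c hc) • p.rep from rfl, tateVectorIntegral_ratVec_smul]

end Series

/-! ## §4 The junction: the middle cell as a finite sum of mirabolic Eisenstein series of Godement sections -/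

section Junction

variable {L : Type} [Field L] [NumberField L] {n : ℕ}
variable [MeasurableSpace (AdeleRing (𝓞 L) L)] [BorelSpace (AdeleRing (𝓞 L) L)]
  (ν : Measure (ideleGroup L)) [ν.IsHaarMeasure]
variable {X : Type*} {I J : Type*} [Fintype I] [Fintype J]

/-- **THE MIDDLE CELL IS A FINITE SUM OF MIRABOLIC EISENSTEIN SERIES OF GODEMENT SECTIONS** (= the `hMID` binder of ★ (γ) `exists_middle_package`).
INPUTS BY VALUE: (α-U) the unfolded middle term `MID s x = c₀ · Σ'_{p ∈ ℙ^{n−1}(L)} φ s x (γ̂_p · m x)` over representatives `γ_p ∈ GL_n(L)` whose `e₀`-row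
spans the line `p` (`hγ`); (β0) the inner section family in a flat basis `φ s x g = Σ_i λ i s x · b i s g`; (β) the Godement exhaust of the flat basis
`b i s g = Σ_j κ i j s · |det g|^{s+½} · Z(Φ i j; s+½; ê₀ g)`, `Φ i j ∈ piSchwartzBruhat`.  OUTPUT on `c < re s` (`½ ≤ c`, so `re(s+½) > 1`):
`MID s x = Σ_{(i,j)} (c₀ · λ i s x · κ i j s) · E(m x, Φ i j; s+½)` — finite sums commute with the absolutely convergent `Σ'_p`, `|det γ̂_p| = 1`, and only
the line of `e₀ γ_p` matters. [cite: MoeglinWaldspurger1995, II.1.7] [cite: CogdellAnalyticTheory2004, §2.3 Thm. 2.2] [cite: JacquetShalikaAJM1981, §4] -/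
theorem middle_eq_sum_mirabolicEisenstein
    (Φ : I → J → (Fin n → AdeleRing (𝓞 L) L) → ℂ) (hΦ : ∀ i j, Φ i j ∈ piSchwartzBruhat L (Fin n))
    (m : X → GL (Fin n) (AdeleRing (𝓞 L) L)) (e₀ : Fin n → L)
    (γ : Projectivization L (Fin n → L) → GL (Fin n) L)
    (hγ : ∀ p, ∃ c : L, c ≠ 0 ∧ e₀ ᵥ* (γ p : Matrix (Fin n) (Fin n) L) = c • p.rep)
    {c : ℝ} (hc : 1 / 2 ≤ c) (c₀ : ℂ) (MID : ℂ → X → ℂ)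
    (φ : ℂ → X → GL (Fin n) (AdeleRing (𝓞 L) L) → ℂ)
    (hMID : ∀ (s : ℂ) (x : X), c < s.re → MID s x = c₀ * ∑' p : Projectivization L (Fin n → L),
      φ s x (Matrix.GeneralLinearGroup.map (algebraMap L (AdeleRing (𝓞 L) L)) (γ p) * m x))
    (lam : I → ℂ → X → ℂ) (b : I → ℂ → GL (Fin n) (AdeleRing (𝓞 L) L) → ℂ)
    (hφ : ∀ (s : ℂ) (x : X) (g : GL (Fin n) (AdeleRing (𝓞 L) L)), c < s.re → φ s x g = ∑ i, lam i s x * b i s g)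
    (κ : I → J → ℂ → ℂ)
    (hb : ∀ (i : I) (s : ℂ) (g : GL (Fin n) (AdeleRing (𝓞 L) L)), c < s.re → b i s g = ∑ j, κ i j s *
      (((IdeleClassGroup.ideleNorm L (Matrix.GeneralLinearGroup.det g) : ℝ) : ℂ) ^ (s + 1 / 2) *
        tateVectorIntegral L ν (Φ i j) (s + 1 / 2) (ratVec L e₀ ᵥ* (g : Matrix (Fin n) (Fin n) (AdeleRing (𝓞 L) L)))))
    (s : ℂ) (x : X) (hs : c < s.re) :
    MID s x = ∑ ij : I × J, (c₀ * lam ij.1 s x * κ ij.1 ij.2 s) * mirabolicEisenstein L ν (Φ ij.1 ij.2) (s + 1 / 2) (m x) := by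
  have hs' : 1 < (s + 1 / 2).re := by
    have : (s + 1 / 2).re = s.re + 1 / 2 := by simp
    rw [this]; linarith
  -- the `p`-summand, unfolded through (β0) and (β)
  set D : ℂ := ((IdeleClassGroup.ideleNorm L (Matrix.GeneralLinearGroup.det (m x)) : ℝ) : ℂ) ^ (s + 1 / 2) with hD
  set Z : I × J → Projectivization L (Fin n → L) → ℂ := fun ij p =>
    tateVectorIntegral L ν (Φ ij.1 ij.2) (s + 1 / 2) (ratVec L p.rep ᵥ* (m x : Matrix (Fin n) (Fin n) (AdeleRing (𝓞 L) L))) with hZ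
  have hsummand : ∀ p : Projectivization L (Fin n → L),
      φ s x (Matrix.GeneralLinearGroup.map (algebraMap L (AdeleRing (𝓞 L) L)) (γ p) * m x) =
        ∑ ij : I × J, lam ij.1 s x * κ ij.1 ij.2 s * (D * Z ij p) := by
    intro p
    obtain ⟨cp, hcp0, hcp⟩ := hγ p
    rw [hφ s x _ hs, Fintype.sum_prod_type]
    refine Finset.sum_congr rfl fun i _ => ?_
    rw [hb i s _ hs, Finset.mul_sum]
    refine Finset.sum_congr rfl fun j _ => ?_
    have hrat := godement_ratGL_mul ν (Φ i j) (s + 1 / 2) e₀ (γ p) (m x)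
    rw [tateVectorIntegral_line ν (Φ i j) (s + 1 / 2) hcp0 hcp] at hrat
    rw [← mul_assoc (κ i j s), mul_assoc (κ i j s), hrat]
    ring
  -- summability of each piece
  have hZs : ∀ ij : I × J, Summable (Z ij) := fun ij =>
    summable_tateVectorIntegral_of_mem_piSchwartzBruhat ν (hΦ ij.1 ij.2) hs' (m x)
  have hpiece : ∀ ij : I × J, Summable fun p => lam ij.1 s x * κ ij.1 ij.2 s * (D * Z ij p) := fun ij =>
    ((hZs ij).mul_left D).mul_left _
  rw [hMID s x hs, tsum_congr hsummand, Summable.tsum_finsetSum (fun ij _ => hpiece ij), Finset.mul_sum]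
  refine Finset.sum_congr rfl fun ij _ => ?_
  rw [tsum_mul_left, tsum_mul_left, hD, mirabolicEisenstein]
  ring

omit [Fintype I] [Fintype J] in
/-- the coefficients `a (i,j) s x := c₀ · λ i s x · κ i j s` are HOLOMORPHIC on `{0 < re}` in `s` (= ★ (γ)'s `had`). [cite: MoeglinWaldspurger1995, IV.1.9] -/
theorem had_of_face (c₀ : ℂ) {lam : I → ℂ → X → ℂ} (hlam : ∀ i x, DifferentiableOn ℂ (fun s => lam i s x) {s : ℂ | 0 < s.re})
    {κ : I → J → ℂ → ℂ} (hκ : ∀ i j, DifferentiableOn ℂ (κ i j) {s : ℂ | 0 < s.re}) (ij : I × J) (x : X) :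
    DifferentiableOn ℂ (fun s => c₀ * lam ij.1 s x * κ ij.1 ij.2 s) {s : ℂ | 0 < s.re} :=
  ((differentiableOn_const c₀).mul (hlam ij.1 x)).mul (hκ ij.1 ij.2)

omit [Fintype I] [Fintype J] in
/-- the coefficients have the LOCAL MODERATE GROWTH of ★ (γ)'s `hag`: `‖a (i,j) s x‖ ≤ C · height x ^ A` near every `z` with `0 < re z`, from local bounds
`‖λ i s x‖ ≤ C_λ height x ^ A` and `‖κ i j s‖ ≤ C_κ`. [cite: MoeglinWaldspurger1995, IV.1.9] -/
theorem hag_of_face (height : X → ℝ) (hpos : ∀ x, 0 < height x) (c₀ : ℂ) {lam : I → ℂ → X → ℂ}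
    (hlam : ∀ z : ℂ, 0 < z.re → ∃ C A r : ℝ, 0 ≤ C ∧ 0 ≤ A ∧ 0 < r ∧ ∀ s : ℂ, dist s z < r → ∀ i x, ‖lam i s x‖ ≤ C * height x ^ A)
    {κ : I → J → ℂ → ℂ} (hκ : ∀ z : ℂ, 0 < z.re → ∃ C r : ℝ, 0 ≤ C ∧ 0 < r ∧ ∀ s : ℂ, dist s z < r → ∀ i j, ‖κ i j s‖ ≤ C)
    (z : ℂ) (hz : 0 < z.re) :
    ∃ C A r : ℝ, 0 ≤ C ∧ 0 ≤ A ∧ 0 < r ∧ ∀ s : ℂ, dist s z < r → ∀ (ij : I × J) (x : X), ‖c₀ * lam ij.1 s x * κ ij.1 ij.2 s‖ ≤ C * height x ^ A := by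
  obtain ⟨Cl, A, rl, hCl, hA, hrl, hl⟩ := hlam z hz
  obtain ⟨Ck, rk, hCk, hrk, hk⟩ := hκ z hz
  refine ⟨‖c₀‖ * Cl * Ck, A, min rl rk, by positivity, hA, lt_min hrl hrk, fun s hs ij x => ?_⟩
  have h1 := hl s (lt_of_lt_of_le hs (min_le_left _ _)) ij.1 x
  have h2 := hk s (lt_of_lt_of_le hs (min_le_right _ _)) ij.1 ij.2
  have hhx : 0 ≤ height x ^ A := Real.rpow_nonneg (hpos x).le _
  rw [norm_mul, norm_mul]
  calc ‖c₀‖ * ‖lam ij.1 s x‖ * ‖κ ij.1 ij.2 s‖ ≤ ‖c₀‖ * (Cl * height x ^ A) * Ck := by gcongr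
    _ = ‖c₀‖ * Cl * Ck * height x ^ A := by ring

end Junction

end Summit.HodgeConjecture.HodgeConjecture.Cruxes.HLiu418.K2LiuMiddleCellGodementJunction

end
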